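import Literature.NumberTheory.NumberFields.EquivariantIwasawaLemmaAbsolute
import Literature.NumberTheory.NumberFields.EquivariantIwasawaLemmaClassGroupSplit
import HarnessLib

/-!
# The equivariant Iwasawa lemma, X: the absolute layer step and the tower with the base hypothesis on
# the `S`-SPLIT class group (Deo–Ray–Sujatha's (c2) as printed) — PROVED

Topic `NumberTheory/NumberFields` (namespace = path, grouping sub-namespace `EquivariantIwasawaLemma`).
THEOREM-ONLY file (no definition, no named fact, no `sorry`), written by the literature seat
`bsd-potss-conjA-anchor` g17 (cell `bsd-potss`; serves the asides stmt-BirchSwinnertonDyer-19386 / 19413;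
closes nothing).  The `S`-versions of file IV (`EquivariantIwasawaLemmaAbsolute.lean`):

* `equivariantHom_classGroup_eq_zero_of_cyclic_layer_absolute_of_splitAt` — file IV's absolute layer step
  `B ≤ F ⊆ k̄` (`[F : k] = p [B : k]`, `Gal(F/B)` central, `V` a `p`-torsion `Γ_k`-module with `Γ_B`
  trivial, (c3*) at the ramified primes, one ramified orbit prime to `p`) with (c2*) at `B` WEAKENED to:
  every `Γ_k`-equivariant additive `μ : Cl(𝓞_B) → V` killing the classes of the primes of `B` above a set
  `Sk` of finite places of `k` is zero — at the price of (c3*) at the primes of `F` above `Sk`.  Proof =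
  file IV's transport to `Bi : IntermediateField k F` verbatim, feeding file IX
  (`equivariantHom_classGroup_eq_zero_of_cyclic_layer_of_classGroup_of_splitAt`); the only new lines move
  the prime `v` of `B` to the prime `gB(v)` of `Bi` and check that it still lies over the same place of `k`.
* `equivariantHom_classGroup_eq_zero_tower_of_splitAt` — along a tower `L₀ ≤ L₁ ≤ ⋯` as in file IV's
  `equivariantHom_classGroup_eq_zero_tower`, the `S`-split hypothesis at `L₀` and (c3*) above `Sk` at the
  primes of `L₁` give: every `Γ_k`-equivariant additive `Cl(𝓞_{L_{n+1}}) → V` is zero for EVERY `n`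
  (layer `1` by the previous theorem, then file IV's tower restarted at `L₁`).  Layer `0` itself is not
  claimed (only its `S`-split part vanishes) — and is not needed by the fine-Selmer application, whose
  descent always lands at a level `≥ 1`.

## References

* L. C. Washington, *Introduction to Cyclotomic Fields*, 2nd ed., GTM 83 (1997), §13.3 Lemmas 13.14–13.15,
  Thm. 10.4. [Washington1997]
* J. Neukirch, *Algebraic Number Theory* (1999), Ch. VI (6.9), (7.1); Ch. IV §6; Ch. I §9. [NeukirchANT1999]
* S. V. Deo, A. Ray, R. Sujatha, Pure Appl. Math. Q. 19 (2023), §3 Thm. 3.8 (c2), (c3), definition of `H′_L`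
  (arXiv:2202.09937 p. 9). [DeoRaySujatha2023]
-/

noncomputable section

open scoped Pointwise nonZeroDivisors
open NumberField Field IntermediateField Ideal IsDedekindDomain
open Literature.NumberTheory.GaloisRepresentations

namespace Literature.NumberTheory.NumberFields

namespace EquivariantIwasawaLemma

section AbsoluteS

variable {k : Type} [Field k]

/-- Restriction `Γ_k → Gal(E/k)` is onto. [folklore] -/
private theorem absRestrictNormalHom_surjectiveS (E : IntermediateField k (AlgebraicClosure k))
    [Normal k E] : Function.Surjective (absRestrictNormalHom E) := fun g => by
  obtain ⟨σ, hσ⟩ := AlgEquiv.restrictNormalHom_surjective (AlgebraicClosure k) g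
  exact ⟨(Field.absoluteGaloisGroup.toAlgEquiv k).symm σ, hσ⟩

/-- `((τ|_E) x : k̄) = τ • x`. [folklore] -/
private theorem coe_absRestrictNormalHom_applyS (E : IntermediateField k (AlgebraicClosure k))
    [Normal k E] (τ : absoluteGaloisGroup k) (x : E) :
    ((absRestrictNormalHom E τ x : E) : AlgebraicClosure k) = τ • (x : AlgebraicClosure k) :=
  AlgEquiv.restrictNormalHom_apply E _ x

/-- `τ|_E = 1` iff `τ` fixes `E ⊆ k̄` pointwise. [folklore] -/
private theorem absRestrictNormalHom_eq_one_iffS (E : IntermediateField k (AlgebraicClosure k))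
    [Normal k E] (τ : absoluteGaloisGroup k) :
    absRestrictNormalHom E τ = 1 ↔ ∀ x : E, τ • (x : AlgebraicClosure k) = x := by
  constructor
  · intro h x
    rw [← coe_absRestrictNormalHom_applyS E τ x, h, AlgEquiv.one_apply]
  · intro h
    ext x
    rw [coe_absRestrictNormalHom_applyS E τ x, AlgEquiv.one_apply]
    exact h x

/-- If `τ` is trivial on `E'` then it is trivial on every `E ≤ E'`. [folklore] -/
private theorem absRestrictNormalHom_eq_one_of_leS {E E' : IntermediateField k (AlgebraicClosure k)}
    [Normal k E] [Normal k E'] (h : E ≤ E') (τ : absoluteGaloisGroup k)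
    (hτ : absRestrictNormalHom E' τ = 1) : absRestrictNormalHom E τ = 1 := by
  rw [absRestrictNormalHom_eq_one_iffS] at hτ ⊢
  exact fun x => hτ ⟨x, h x.2⟩

/-- A ring isomorphism maps non-zero ideals to non-zero ideals. [folklore] -/
private theorem map_mem_nonZeroDivisorsS {R S : Type*} [CommRing R] [IsDomain R] [CommRing S]
    [IsDomain S] (g : R ≃+* S) (J : (Ideal R)⁰) : (J : Ideal R).map (g : R →+* S) ∈ (Ideal S)⁰ := by
  rw [mem_nonZeroDivisors_iff_ne_zero]
  intro h
  exact nonZeroDivisors.ne_zero J.2 ((Ideal.map_eq_bot_iff_of_injective g.injective).mp h)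

/-- `ClassGroup.mulEquiv g` on the class of an integral ideal `J` is the class of `g(J)`. [folklore] -/
private theorem mulEquiv_mk0S {R S : Type*} [CommRing R] [IsDedekindDomain R] [CommRing S]
    [IsDedekindDomain S] (g : R ≃+* S) (J : (Ideal R)⁰) :
    ClassGroup.mulEquiv g (ClassGroup.mk0 J) =
      ClassGroup.mk0 ⟨_, map_mem_nonZeroDivisorsS g J⟩ := by
  have hmk : ∀ I : (FractionalIdeal R⁰ (FractionRing R))ˣ,
      ClassGroup.mulEquiv g (ClassGroup.mk (FractionRing R) I) =
        ClassGroup.mk (FractionRing S) (Units.mapEquiv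
          (FractionalIdeal.ringEquivOfRingEquiv (FractionRing R) (FractionRing S) g).toMulEquiv I) :=
    fun I => by
    rw [ClassGroup.mulEquiv, MulEquiv.trans_apply, MulEquiv.trans_apply, ClassGroup.equiv_mk,
      MulEquiv.symm_apply_eq, ClassGroup.equiv_mk, QuotientGroup.congr_mk']
    congr 1
    ext1
    simp [FractionalIdeal.canonicalEquiv_self]
  rw [← ClassGroup.mk_mk0 (FractionRing R) J, hmk, ← ClassGroup.mk_mk0 (FractionRing S)]
  congr 1
  ext1
  rw [Units.coe_mapEquiv, FractionalIdeal.coe_mk0, FractionalIdeal.coe_mk0]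
  exact AmbiguousClass.ringEquivOfRingEquiv_coeIdeal _ _ g J

variable [NumberField k]

set_option maxHeartbeats 400000 in
/-- **The equivariant Iwasawa lemma, absolute form, with the base hypothesis on the `S`-split class
group.**  As `equivariantHom_classGroup_eq_zero_of_cyclic_layer_absolute` (file IV), but (c2*) at `B` is
weakened to: every additive `Γ_k`-equivariant `μ : Cl(𝓞_B) → V` killing the classes `[v]` of the primes
`v` of `B` above the places in `Sk` is zero (Deo–Ray–Sujatha's `Hom_G(H′_B, V) = 0`), and (c3*) is
assumed in addition at the primes of `F` above `Sk`.  Conclusion unchanged: every additive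
`Γ_k`-equivariant `f : Cl(𝓞_F) → V` is zero.
[cite: Washington1997, §13.3 Lemmas 13.14–13.15 and Thm. 10.4 (proof)]
[cite: NeukirchANT1999, Ch. VI (6.9), (7.1), Ch. IV §6 and Ch. I §9 (9.4)–(9.6)]
[cite: DeoRaySujatha2023, §3 Thm. 3.8 (c2), (c3) and the definition of H′_L (arXiv:2202.09937 p. 9)] -/
theorem equivariantHom_classGroup_eq_zero_of_cyclic_layer_absolute_of_splitAt (p : ℕ) [Fact p.Prime]
    (hp2 : p ≠ 2) {B F : IntermediateField k (AlgebraicClosure k)} (hBF : B ≤ F)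
    [NumberField B] [NumberField F] [IsGalois k B] [IsGalois k F]
    (hdeg : Module.finrank k F = p * Module.finrank k B)
    (hcent : ∀ σ τ : absoluteGaloisGroup k, absRestrictNormalHom B σ = 1 →
      absRestrictNormalHom F (σ * τ) = absRestrictNormalHom F (τ * σ))
    {V : Type*} [AddCommGroup V] [DistribMulAction (absoluteGaloisGroup k) V]
    (hpV : ∀ v : V, p • v = 0)
    (hV : ∀ τ : absoluteGaloisGroup k, absRestrictNormalHom B τ = 1 → ∀ v : V, τ • v = v)
    (Sk : HeightOneSpectrum (𝓞 k) → Prop)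
    (hDbad : ∀ (𝔓 : Ideal (𝓞 F)) [𝔓.IsMaximal] (u : HeightOneSpectrum (𝓞 k)), Sk u →
      𝔓.under (𝓞 k) = u.asIdeal →
      ∀ v : V, (∀ τ : absoluteGaloisGroup k, absRestrictNormalHom F τ • 𝔓 = 𝔓 → τ • v = v) → v = 0)
    (h0 : ∀ μ : Additive (ClassGroup (𝓞 B)) →+ V,
      (∀ (τ : absoluteGaloisGroup k) (c : ClassGroup (𝓞 B)),
        μ (Additive.ofMul (ClassGroup.mulEquiv
          (AmbiguousClass.intAut (absRestrictNormalHom B τ)) c)) = τ • μ (Additive.ofMul c)) →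
      (∀ (v : HeightOneSpectrum (𝓞 B)) (u : HeightOneSpectrum (𝓞 k)), Sk u →
        v.asIdeal.under (𝓞 k) = u.asIdeal →
        μ (Additive.ofMul (ClassGroup.mk0 ⟨v.asIdeal, mem_nonZeroDivisors_of_ne_zero v.ne_bot⟩)) = 0) →
      μ = 0)
    (hD : ∀ (𝔓 : Ideal (𝓞 F)) [𝔓.IsMaximal],
      (∃ σ : absoluteGaloisGroup k, absRestrictNormalHom F σ ∈ 𝔓.inertia (F ≃ₐ[k] F) ∧
        absRestrictNormalHom F σ ≠ 1 ∧ absRestrictNormalHom B σ = 1) →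
      ∀ v : V, (∀ τ : absoluteGaloisGroup k, absRestrictNormalHom F τ • 𝔓 = 𝔓 → τ • v = v) →
        v = 0)
    (horb : ∃ (𝔓₀ : Ideal (𝓞 F)) (_ : 𝔓₀.IsMaximal),
      (∃ σ : absoluteGaloisGroup k, absRestrictNormalHom F σ ∈ 𝔓₀.inertia (F ≃ₐ[k] F) ∧
        absRestrictNormalHom F σ ≠ 1 ∧ absRestrictNormalHom B σ = 1) ∧
      ¬ p ∣ (MulAction.stabilizer (F ≃ₐ[k] F) 𝔓₀).index)
    (f : Additive (ClassGroup (𝓞 F)) →+ V)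
    (hf : ∀ (τ : absoluteGaloisGroup k) (c : ClassGroup (𝓞 F)),
      f (Additive.ofMul (ClassGroup.mulEquiv
        (AmbiguousClass.intAut (absRestrictNormalHom F τ)) c)) = τ • f (Additive.ofMul c)) :
    f = 0 := by
  classical
  have hp : p.Prime := Fact.out
  -- ### `B` as an intermediate field `Bi` of `F/k`, `eB : B ≃ₐ[k] Bi`
  set Bi : IntermediateField k F := IntermediateField.restrict hBF with hBidef
  set eB : B ≃ₐ[k] Bi := IntermediateField.restrict_algEquiv hBF with heBdef
  have heB : ∀ y : B, (((eB y : Bi) : F) : AlgebraicClosure k) = (y : AlgebraicClosure k) :=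
    fun _ => rfl
  have hmemB : ∀ x : Bi, ((x : F) : AlgebraicClosure k) ∈ B := fun x => (mem_restrict hBF x.1).1 x.2
  haveI : IsGalois k Bi := IsGalois.of_algEquiv eB
  set π : absoluteGaloisGroup k →* (F ≃ₐ[k] F) := absRestrictNormalHom F with hπdef
  have hπ : Function.Surjective π := absRestrictNormalHom_surjectiveS F
  have hval : ∀ (τ : absoluteGaloisGroup k) (x : F),
      ((π τ x : F) : AlgebraicClosure k) = τ • (x : AlgebraicClosure k) :=
    coe_absRestrictNormalHom_applyS F
  -- `τ|_B = 1 ↔ π τ fixes Bi pointwise`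
  have hB1 : ∀ τ : absoluteGaloisGroup k,
      absRestrictNormalHom B τ = 1 ↔ ∀ x : Bi, π τ (x : F) = x := by
    intro τ
    rw [absRestrictNormalHom_eq_one_iffS]
    constructor
    · intro h x
      apply Subtype.ext
      rw [hval]
      exact h ⟨_, hmemB x⟩
    · intro h y
      have := congrArg (fun z : F => (z : AlgebraicClosure k)) (h (eB y))
      rwa [hval] at this
  -- ### degree `[F : Bi] = p`, `F/Bi` unramified at infinity
  have hdeg' : Module.finrank Bi F = p := by
    have h1 : Module.finrank k B = Module.finrank k Bi := eB.toLinearEquiv.finrank_eq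
    have h2 := Module.finrank_mul_finrank k Bi F
    rw [← h1, hdeg, mul_comm p] at h2
    exact mul_left_cancel₀ (Module.finrank_pos (R := k) (M := B)).ne' h2
  haveI : IsUnramifiedAtInfinitePlaces Bi F :=
    IsUnramifiedAtInfinitePlaces_of_odd_finrank (by rw [hdeg']; exact hp.odd_of_ne_two hp2)
  -- `#I(𝔓) = e(𝔓 | Bi)` in `Gal(F/Bi)`
  have hcardI : ∀ (𝔓 : Ideal (𝓞 F)) [𝔓.IsMaximal],
      Nat.card (𝔓.inertia (F ≃ₐ[Bi] F)) = 𝔓.ramificationIdx (𝓞 Bi) := fun 𝔓 _ =>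
    card_inertia_eq_ramificationIdx F (F ≃ₐ[Bi] F) Bi 𝔓
  -- ### ramified over `Bi` ↔ the `Γ_k`-form
  have hram_of : ∀ (𝔓 : Ideal (𝓞 F)) [𝔓.IsMaximal], 𝔓.ramificationIdx (𝓞 Bi) ≠ 1 →
      ∃ σ : absoluteGaloisGroup k, π σ ∈ 𝔓.inertia (F ≃ₐ[k] F) ∧ π σ ≠ 1 ∧
        absRestrictNormalHom B σ = 1 := by
    intro 𝔓 _ hne
    have hbot : 𝔓.inertia (F ≃ₐ[Bi] F) ≠ ⊥ := by
      intro h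
      apply hne
      rw [← hcardI 𝔓, h, Subgroup.card_bot]
    obtain ⟨σ, hσI, hσ1⟩ := (Subgroup.bot_or_exists_ne_one _).resolve_left hbot
    obtain ⟨σ', hσ'⟩ := hπ (σ.restrictScalars k)
    refine ⟨σ', ?_, ?_, ?_⟩
    · rw [hσ']
      exact fun x => hσI x
    · rw [hσ']
      intro h
      apply hσ1
      exact AlgEquiv.ext fun x => congrArg (fun g : F ≃ₐ[k] F => g x) h
    · refine (hB1 σ').mpr fun x => ?_
      rw [hσ']
      exact σ.commutes x
  have hof_ram : ∀ (𝔓 : Ideal (𝓞 F)) [𝔓.IsMaximal],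
      (∃ σ : absoluteGaloisGroup k, π σ ∈ 𝔓.inertia (F ≃ₐ[k] F) ∧ π σ ≠ 1 ∧
        absRestrictNormalHom B σ = 1) → 𝔓.ramificationIdx (𝓞 Bi) ≠ 1 := by
    rintro 𝔓 _ ⟨σ', hI, hne, hB⟩ h1
    have hmem : π σ' ∈ Bi.fixingSubgroup :=
      (IntermediateField.mem_fixingSubgroup_iff _ _).mpr fun x hx => (hB1 σ').mp hB ⟨x, hx⟩
    set σ : F ≃ₐ[Bi] F := IntermediateField.fixingSubgroupEquiv Bi ⟨π σ', hmem⟩ with hσdef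
    have hσI : σ ∈ 𝔓.inertia (F ≃ₐ[Bi] F) := fun x => hI x
    have hbot : 𝔓.inertia (F ≃ₐ[Bi] F) = ⊥ := by
      rw [← Subgroup.card_eq_one, hcardI 𝔓, h1]
    rw [hbot, Subgroup.mem_bot] at hσI
    apply hne
    exact AlgEquiv.ext fun x => congrArg (fun g : F ≃ₐ[Bi] F => g x) hσI
  -- ### apply file III with `B := Bi`
  refine equivariantHom_classGroup_eq_zero_of_cyclic_layer_of_classGroup_of_splitAt (k := k) (B := Bi)
    (F := F) p hdeg' ?_ π hπ hpV ?_
    (fun v' => ∃ u : HeightOneSpectrum (𝓞 k), Sk u ∧ v'.asIdeal.under (𝓞 k) = u.asIdeal) ?_ ?_ ?_ ?_ f hf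
  · -- `Gal(F/Bi)` central
    intro σ τ x
    obtain ⟨σ', hσ'⟩ := hπ (σ.restrictScalars k)
    obtain ⟨τ', rfl⟩ := hπ τ
    have hB : absRestrictNormalHom B σ' = 1 :=
      (hB1 σ').mpr fun y => by rw [hσ']; exact σ.commutes y
    have h := hcent σ' τ' hB
    rw [map_mul, map_mul, hσ'] at h
    have hx := congrArg (fun g : F ≃ₐ[k] F => g x) h
    simpa only [AlgEquiv.mul_apply, AlgEquiv.restrictScalars_apply] using hx.symm
  · -- `Γ_{Bi}` acts trivially
    intro τ hτ
    exact hV τ ((hB1 τ).mpr fun x => hτ x)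
  · -- (c3*) at the primes of `F` above `Sk`
    rintro 𝔓 _ v' ⟨u, hu, hv'u⟩ h𝔓v' x hx
    refine hDbad 𝔓 u hu ?_ x hx
    rw [← Ideal.under_under 𝔓 (B := 𝓞 Bi), h𝔓v', hv'u]
  · -- (c2) for `Bi`, transported along `eB`
    intro μ hμ hμS
    set gB : 𝓞 B ≃+* 𝓞 Bi := RingOfIntegers.mapRingEquiv eB.toRingEquiv with hgBdef
    set eCl : ClassGroup (𝓞 B) ≃* ClassGroup (𝓞 Bi) := ClassGroup.mulEquiv gB with heCldef
    set μ' : Additive (ClassGroup (𝓞 B)) →+ V :=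
      AddMonoidHom.mk' (fun a => μ (Additive.ofMul (eCl (Additive.toMul a))))
        (fun a b => by simp only [toMul_add, map_mul, ofMul_mul, map_add]) with hμ'def
    have hμ'apply : ∀ c : ClassGroup (𝓞 B),
        μ' (Additive.ofMul c) = μ (Additive.ofMul (eCl c)) := fun _ => rfl
    -- compatibility of `gB`, `eCl` with the two Galois actions
    have hgcomp : ∀ τ : absoluteGaloisGroup k,
        (gB : 𝓞 B →+* 𝓞 Bi).comp (AmbiguousClass.intAut (absRestrictNormalHom B τ) : 𝓞 B →+* 𝓞 B) =
          (AmbiguousClass.intAut ((π τ).restrictNormal Bi) : 𝓞 Bi →+* 𝓞 Bi).comp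
            (gB : 𝓞 B →+* 𝓞 Bi) := by
      intro τ
      refine RingHom.ext fun y => Subtype.ext <| Subtype.ext <| Subtype.ext ?_
      change (((eB (absRestrictNormalHom B τ (y : B)) : Bi) : F) : AlgebraicClosure k) =
        ((algebraMap Bi F (((π τ).restrictNormal Bi) (eB (y : B))) : F) : AlgebraicClosure k)
      rw [AlgEquiv.restrictNormal_commutes, heB, coe_absRestrictNormalHom_applyS B, hval]
      rfl
    have hcomp : ∀ (τ : absoluteGaloisGroup k) (c : ClassGroup (𝓞 B)),
        eCl (ClassGroup.mulEquiv (AmbiguousClass.intAut (absRestrictNormalHom B τ)) c) =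
          ClassGroup.mulEquiv (AmbiguousClass.intAut ((π τ).restrictNormal Bi)) (eCl c) := by
      intro τ c
      obtain ⟨J, rfl⟩ := ClassGroup.mk0_surjective c
      rw [AmbiguousClass.mulEquiv_mk0, heCldef, mulEquiv_mk0S, mulEquiv_mk0S,
        AmbiguousClass.mulEquiv_mk0]
      congr 1
      apply Subtype.ext
      change ((J : Ideal (𝓞 B)).map _).map _ = ((J : Ideal (𝓞 B)).map _).map _
      rw [Ideal.map_map, Ideal.map_map, hgcomp]
    -- `gB` is compatible with `𝓞 k`
    have hgBalg : ∀ x : 𝓞 k, gB (algebraMap (𝓞 k) (𝓞 B) x) = algebraMap (𝓞 k) (𝓞 Bi) x := by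
      intro x
      apply RingOfIntegers.coe_injective
      change eB (algebraMap k B (x : k)) = algebraMap k Bi (x : k)
      exact eB.commutes (x : k)
    have hμ' : μ' = 0 := by
      refine h0 μ' (fun τ c => ?_) (fun v u hu hvu => ?_)
      · rw [hμ'apply, hμ'apply, hcomp]
        exact hμ τ (eCl c)
      · rw [hμ'apply, heCldef, mulEquiv_mk0S]
        haveI : (v.asIdeal.map (gB : 𝓞 B →+* 𝓞 Bi)).IsPrime := Ideal.map_isPrime_of_equiv gB
        have hne : v.asIdeal.map (gB : 𝓞 B →+* 𝓞 Bi) ≠ ⊥ := fun h =>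
          v.ne_bot ((Ideal.map_eq_bot_iff_of_injective gB.injective).mp h)
        set v' : HeightOneSpectrum (𝓞 Bi) := ⟨v.asIdeal.map (gB : 𝓞 B →+* 𝓞 Bi), inferInstance, hne⟩
          with hv'def
        have hv'u : v'.asIdeal.under (𝓞 k) = u.asIdeal := by
          rw [← hvu, Ideal.under_def, Ideal.under_def]
          ext x
          rw [Ideal.mem_comap, Ideal.mem_comap, hv'def, ← hgBalg]
          change (gB : 𝓞 B →+* 𝓞 Bi) (algebraMap (𝓞 k) (𝓞 B) x) ∈
            Ideal.map (gB : 𝓞 B →+* 𝓞 Bi) v.asIdeal ↔ _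
          rw [← Ideal.mem_comap, Ideal.comap_map_of_bijective (gB : 𝓞 B →+* 𝓞 Bi)
            (show Function.Bijective (gB : 𝓞 B →+* 𝓞 Bi) from gB.bijective)]
        have h := hμS v' ⟨u, hu, hv'u⟩
        exact h
    refine AddMonoidHom.ext fun a => ?_
    obtain ⟨c, rfl⟩ : ∃ c : ClassGroup (𝓞 Bi), Additive.ofMul c = a := ⟨Additive.toMul a, rfl⟩
    have h := congrArg (fun ν : Additive (ClassGroup (𝓞 B)) →+ V => ν (Additive.ofMul (eCl.symm c))) hμ'
    simpa only [hμ'apply, MulEquiv.apply_symm_apply, AddMonoidHom.zero_apply] using h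
  · -- (c3*)
    intro 𝔓 _ hne v hv
    exact hD 𝔓 (hram_of 𝔓 hne) v hv
  · -- one ramified orbit prime to `p`
    obtain ⟨𝔓₀, h𝔓₀, hram, hidx⟩ := horb
    exact ⟨𝔓₀, h𝔓₀, hof_ram 𝔓₀ hram, hidx⟩

/-! ### The tower -/

set_option maxHeartbeats 400000 in
/-- **The tower with the base hypothesis on the `S`-split class group.**  As
`equivariantHom_classGroup_eq_zero_tower` (file IV): `L₀ ≤ L₁ ≤ ⋯ ⊆ k̄` finite Galois over the number
field `k`, `[L_{n+1} : k] = p [L_n : k]`, `Gal(L_{n+1}/L_n)` central, `V` a `p`-torsion `Γ_k`-module with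
`Γ_{L₀}` trivial, (c3*)ₙ and an orbit condition at every layer; but at the bottom only
`Hom_{Γ_k}(H′_{L₀,Sk}, V) = 0` (every equivariant additive `Cl(𝓞_{L₀}) → V` killing the classes of the
primes above `Sk` vanishes), plus (c3*) at the primes of `L₁` above `Sk`.  THEN for every `n` every
additive `Γ_k`-equivariant `Cl(𝓞_{L_{n+1}}) → V` is zero: layer `1` by
`equivariantHom_classGroup_eq_zero_of_cyclic_layer_absolute_of_splitAt`, the higher layers by file IV's
tower restarted at `L₁`.
[cite: Washington1997, §13.3 Lemmas 13.14–13.15 and Thm. 10.4 (proof)]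
[cite: DeoRaySujatha2023, §3 Thm. 3.8 (c2), (c3) (arXiv:2202.09937 p. 9)] -/
theorem equivariantHom_classGroup_eq_zero_tower_of_splitAt (p : ℕ) [Fact p.Prime] (hp2 : p ≠ 2)
    (L : ℕ → IntermediateField k (AlgebraicClosure k)) (hmono : ∀ n, L n ≤ L (n + 1))
    [hNF : ∀ n, NumberField (L n)] [hGal : ∀ n, IsGalois k (L n)]
    (hdeg : ∀ n, Module.finrank k (L (n + 1)) = p * Module.finrank k (L n))
    (hcent : ∀ (n : ℕ) (σ τ : absoluteGaloisGroup k), absRestrictNormalHom (L n) σ = 1 →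
      absRestrictNormalHom (L (n + 1)) (σ * τ) = absRestrictNormalHom (L (n + 1)) (τ * σ))
    {V : Type*} [AddCommGroup V] [DistribMulAction (absoluteGaloisGroup k) V]
    (hpV : ∀ v : V, p • v = 0)
    (hV : ∀ τ : absoluteGaloisGroup k, absRestrictNormalHom (L 0) τ = 1 → ∀ v : V, τ • v = v)
    (hD : ∀ (n : ℕ) (𝔓 : Ideal (𝓞 (L (n + 1)))) [𝔓.IsMaximal],
      (∃ σ : absoluteGaloisGroup k,
        absRestrictNormalHom (L (n + 1)) σ ∈ 𝔓.inertia (L (n + 1) ≃ₐ[k] L (n + 1)) ∧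
        absRestrictNormalHom (L (n + 1)) σ ≠ 1 ∧ absRestrictNormalHom (L n) σ = 1) →
      ∀ v : V, (∀ τ : absoluteGaloisGroup k,
        absRestrictNormalHom (L (n + 1)) τ • 𝔓 = 𝔓 → τ • v = v) → v = 0)
    (horb : ∀ n : ℕ, ∃ (𝔓₀ : Ideal (𝓞 (L (n + 1)))) (_ : 𝔓₀.IsMaximal),
      (∃ σ : absoluteGaloisGroup k,
        absRestrictNormalHom (L (n + 1)) σ ∈ 𝔓₀.inertia (L (n + 1) ≃ₐ[k] L (n + 1)) ∧
        absRestrictNormalHom (L (n + 1)) σ ≠ 1 ∧ absRestrictNormalHom (L n) σ = 1) ∧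
      ¬ p ∣ (MulAction.stabilizer (L (n + 1) ≃ₐ[k] L (n + 1)) 𝔓₀).index)
    (Sk : HeightOneSpectrum (𝓞 k) → Prop)
    (hDbad : ∀ (𝔓 : Ideal (𝓞 (L 1))) [𝔓.IsMaximal] (u : HeightOneSpectrum (𝓞 k)), Sk u →
      𝔓.under (𝓞 k) = u.asIdeal →
      ∀ v : V, (∀ τ : absoluteGaloisGroup k, absRestrictNormalHom (L 1) τ • 𝔓 = 𝔓 → τ • v = v) →
        v = 0)
    (h0 : ∀ μ : Additive (ClassGroup (𝓞 (L 0))) →+ V,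
      (∀ (τ : absoluteGaloisGroup k) (c : ClassGroup (𝓞 (L 0))),
        μ (Additive.ofMul (ClassGroup.mulEquiv
          (AmbiguousClass.intAut (absRestrictNormalHom (L 0) τ)) c)) = τ • μ (Additive.ofMul c)) →
      (∀ (v : HeightOneSpectrum (𝓞 (L 0))) (u : HeightOneSpectrum (𝓞 k)), Sk u →
        v.asIdeal.under (𝓞 k) = u.asIdeal →
        μ (Additive.ofMul (ClassGroup.mk0 ⟨v.asIdeal, mem_nonZeroDivisors_of_ne_zero v.ne_bot⟩)) = 0) →
      μ = 0)
    (n : ℕ) (f : Additive (ClassGroup (𝓞 (L (n + 1)))) →+ V)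
    (hf : ∀ (τ : absoluteGaloisGroup k) (c : ClassGroup (𝓞 (L (n + 1)))),
      f (Additive.ofMul (ClassGroup.mulEquiv
        (AmbiguousClass.intAut (absRestrictNormalHom (L (n + 1)) τ)) c)) = τ • f (Additive.ofMul c)) :
    f = 0 := by
  have h1 : ∀ g : Additive (ClassGroup (𝓞 (L 1))) →+ V,
      (∀ (τ : absoluteGaloisGroup k) (c : ClassGroup (𝓞 (L 1))),
        g (Additive.ofMul (ClassGroup.mulEquiv
          (AmbiguousClass.intAut (absRestrictNormalHom (L 1) τ)) c)) = τ • g (Additive.ofMul c)) →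
      g = 0 := fun g hg =>
    equivariantHom_classGroup_eq_zero_of_cyclic_layer_absolute_of_splitAt p hp2 (hmono 0) (hdeg 0)
      (hcent 0) hpV hV Sk hDbad h0 (fun 𝔓 _ => hD 0 𝔓) (horb 0) g hg
  exact equivariantHom_classGroup_eq_zero_tower p hp2 (fun m => L (m + 1)) (fun m => hmono (m + 1))
    (fun m => hdeg (m + 1)) (fun m => hcent (m + 1)) hpV
    (fun τ hτ => hV τ (absRestrictNormalHom_eq_one_of_leS (hmono 0) τ hτ))
    (fun m 𝔓 _ => hD (m + 1) 𝔓) (fun m => horb (m + 1)) h1 n f hf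

end AbsoluteS

end EquivariantIwasawaLemma

end Literature.NumberTheory.NumberFields

end
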